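import Mathlib
import Literature.Analysis.FluidPDE.TypeIAncientMild
import Literature.Analysis.FluidPDE.NewtonKernel
import Literature.Analysis.FluidPDE.ClassicalLerayProjection

/-!
# Crux `FarPastLedger` (stmt-NavierStokesRegularity-14060) — ideator 3, round 1: first lemmas

Sketch file for the two crux idea cards of this seat:

* `uloc-gronwall-transplant` — the ledger is a LINEAR Volterra inequality in time for the
  uniformly-local energy `F_R(τ) = sup_{x'} ∫_{B_R(x')} |u(τ)|²` with the L¹-in-time coefficient
  `a(τ) = A/R² + B·C/(√(-τ)·R)`; Gronwall from the entry time `t - R²` closes it with no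
  bootstrap and no logarithm (`LinearFluxLedger`, `GronwallClosure`, `crossing_number_le`).
* `test-side-leray-projection` — the pressure never appears: the local energy balance of an
  Oseen-mild field against a cut-off `φ` carries the flux `-2 ∫ D²π[φu](u,u)` (`π = divPotential`,
  the Newtonian potential of the mean-zero annular source `div(φu) = u·∇φ`) in place of `2∫ p u·∇φ`
  (`projDefectPairing`, `ProjectedEnergyIdentity`, `TestSideFluxBound`).

Everything here is a `Prop` (statement only) except the two elementary lemmas at the end, which
are proved. Namespace as required for crux work files.
-/

noncomputable section

namespace Summit.NavierStokesRegularity.NavierStokesRegularity.Cruxes.FarPastLedger.Ideator3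

open MeasureTheory Set Metric Real
open Literature.Analysis.FluidPDE
open scoped RealInnerProductSpace Laplacian ContDiff

local notation "ℝ³" => EuclideanSpace ℝ (Fin 3)

/-! ## Card `uloc-gronwall-transplant` -/

/-- **First lemma of card `uloc-gronwall-transplant` (the linear flux ledger).** There are
absolute constants `N, A, B` such that for every `u ∈ A_C` (`IsTypeIAncientMild C u`), every
radius `R > 0`, every pair of times `s < t < 0` and every majorant `F` of the uniformly-local
energies at radius `R` on `[s, t]` (`∫_{B_R(x')} |u(τ)|² ≤ F(τ)` for all centres `x'`), the energy
in ANY ball of radius `R` at time `t` is bounded by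
`N·F(s) + N ∫_s^t (A/R² + B·C/(√(-τ) R)) F(τ) dτ`.
Content: local energy identity on `B_{2R}(x₀)` with a cut-off (`ClassicalLocalEnergyCutoff`),
cubic flux and near (Plancherel, `stein1970_normalisedPressure_eLpNorm_le_holds`) / far (dipole
kernel `|∇K| ≲ |z|⁻⁴`, dyadic shells, covering numbers) pressure flux — every term is CUBIC in `u`,
and exactly one factor is spent on `‖u(τ)‖_∞ ≤ C/√(-τ)`, so the inequality is LINEAR in `F` with a
coefficient integrable up to `τ = 0⁻`. -/
def LinearFluxLedger : Prop :=
  ∃ N A B : ℝ, 0 ≤ N ∧ 0 ≤ A ∧ 0 ≤ B ∧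
    ∀ (C : ℝ) (u : ℝ → ℝ³ → ℝ³), IsTypeIAncientMild C u →
      ∀ R : ℝ, 0 < R → ∀ s t : ℝ, s < t → t < 0 →
        ∀ F : ℝ → ℝ,
          (∀ τ ∈ Icc s t, ∀ x' : ℝ³, ∫ x in ball x' R, ‖u τ x‖ ^ 2 ≤ F τ) →
          IntegrableOn F (Icc s t) →
          ∀ x₀ : ℝ³,
            ∫ x in ball x₀ R, ‖u t x‖ ^ 2 ≤
              N * F s + N * ∫ τ in s..t, (A / R ^ 2 + B * C / (Real.sqrt (-τ) * R)) * F τ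

/-- **The closing lemma of card `uloc-gronwall-transplant` (integral Grönwall, pure real
analysis).** A bounded measurable nonnegative `F` on `[s, t]` with
`F(σ) ≤ K + ∫_s^σ a F` for all `σ ∈ [s,t]`, `a ≥ 0` integrable, satisfies
`F(t) ≤ K · exp(∫_s^t a)`. (The uloc energy `F_R` is a supremum of continuous functions of `τ`,
hence lower semicontinuous and measurable, and is bounded by `C²|B_R|/(-t)` on `[s,t]`.) -/
def GronwallClosure : Prop :=
  ∀ (s t K : ℝ) (a F : ℝ → ℝ), s ≤ t → 0 ≤ K →
    (∀ τ ∈ Icc s t, 0 ≤ a τ) → IntegrableOn a (Icc s t) →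
    (∀ τ ∈ Icc s t, 0 ≤ F τ) → Measurable F → (∃ M : ℝ, ∀ τ ∈ Icc s t, F τ ≤ M) →
    (∀ σ ∈ Icc s t, F σ ≤ K + ∫ τ in s..σ, a τ * F τ) →
    F t ≤ K * Real.exp (∫ τ in s..t, a τ)

/-- The crux, verbatim: the ledger signature of item stmt-NavierStokesRegularity-14060 =
`Summit.NavierStokesRegularity.NavierStokesRegularity.Theses.SymmetryModuliCount.FarPastLedger`
(pasted rather than imported: the farm's build of the route module predates rev 7, cf. the
refuter's note on the item, 2026-08-16T02:25Z). -/
def FarPastLedgerSig : Prop :=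
  ∀ C : ℝ, ∃ K : ℝ, ∀ (u : ℝ → EuclideanSpace ℝ (Fin 3) → EuclideanSpace ℝ (Fin 3)),
    Literature.Analysis.FluidPDE.IsTypeIAncientMild C u → ∀ t < 0,
      ∀ (x₀ : EuclideanSpace ℝ (Fin 3)) (R : ℝ), 0 < R →
        ∫ x in Metric.ball x₀ R, ‖u t x‖ ^ 2 ≤ K * R

/-- **The card's claim in closed form (what the two lemmas give, with the entry time `s = t - R²`):**
`FarPastLedger` with the explicit constant `K(C) = N·(32π/3)·C²·exp(N(A + 2BC))` — no bootstrap,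
no logarithm, every radius (`r₀ = ∞` in Barker–Prange's notation (e.typeI)). Stated here as the
implication the crux-plan skeleton would have to realise. -/
def UlocGronwallClosesLedger : Prop :=
  LinearFluxLedger → GronwallClosure → FarPastLedgerSig

/-! ## Card `test-side-leray-projection` -/

/-- The **projection-defect pairing** `∫ ⟪D(∇π[G])(x)(v x), v x⟫ dx = Σᵢⱼ ∫ vᵢvⱼ ∂ᵢ∂ⱼπ[G]`, where
`π[G] = Δ⁻¹ div G` is the tree's Newtonian potential of the divergence (`divPotential`,
`ClassicalLerayProjection.lean`) and `P[G] = G − ∇π[G]` the classical Leray projection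
(`classicalLerayProj_apply`). With `G = φu(τ)` and `div u = 0`, `div G = u·∇φ =: g` is a smooth
MEAN-ZERO source supported in the annulus `supp ∇φ`, and `D²π[G] = (RᵢRⱼ g)ᵢⱼ` is smooth, in `L²`
(`Σ‖∂ᵢ∂ⱼπ‖₂² = ‖g‖₂²`, Hessian–Laplacian) and `O(R‖g‖₁|x - x₀|⁻⁴)` off the support (two-centre
kernel bound). This pairing is the ONLY place the nonlocality of Navier–Stokes enters the ledger
in the test-side formulation — no scalar pressure is ever formed. -/
def projDefectPairing (G : ℝ³ → ℝ³) (v : ℝ³ → ℝ³) : ℝ :=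
  ∫ x, ⟪fderiv ℝ (gradient (divPotential G)) x (v x), v x⟫

/-- **First lemma of card `test-side-leray-projection` (the projected energy identity, no
pressure).** For `u ∈ A_C`, a smooth compactly supported cut-off `φ` and `s < t < 0`:
`∫φ|u(t)|² − ∫φ|u(s)|² + 2∫_s^t∫φ|∇u|² = ∫_s^t [∫|u|²Δφ + ∫|u|²(u·∇φ) − 2·∫D²π[φu](u,u)] dτ`.
Derivation from the Oseen identity alone: differentiate the Duhamel term in `t`, pair with the
(non-solenoidal) test field `φu`, move the symmetric Oseen kernel onto it
(`OseenHeatDuality`, `OseenTensorRepresentation`), and use the Helmholtz decomposition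
`P[φu] = φu − ∇π[φu]` of the `C_c^∞` field `φu` (`classicalLerayProj_apply`) — the scalar
pressure, its BMO class and its identification ("pinning") never occur. -/
def ProjectedEnergyIdentity : Prop :=
  ∀ (C : ℝ) (u : ℝ → ℝ³ → ℝ³), IsTypeIAncientMild C u →
    ∀ φ : ℝ³ → ℝ, ContDiff ℝ ∞ φ → HasCompactSupport φ →
      ∀ s t : ℝ, s < t → t < 0 →
        (∫ x, φ x * ‖u t x‖ ^ 2) - (∫ x, φ x * ‖u s x‖ ^ 2)
            + 2 * ∫ τ in s..t, ∫ x, φ x * ‖fderiv ℝ (u τ) x‖ ^ 2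
          = ∫ τ in s..t,
              ((∫ x, ‖u τ x‖ ^ 2 * (Δ φ) x) + (∫ x, ‖u τ x‖ ^ 2 * ⟪u τ x, gradient φ x⟫)
                - 2 * projDefectPairing (fun x => φ x • u τ x) (u τ))

/-- **Second lemma of card `test-side-leray-projection` (the test-side flux bound, linear in the
uloc energy).** There is an absolute `B` such that for `u ∈ A_C`, a cut-off `φ` at scale `R` about
`x₀` (`supp φ ⊆ B̄_{2R}(x₀)`, `‖∇φ‖ ≤ 1/R`), a time `τ < 0` and any bound `F` of the energies of `u(τ)`
in balls of radius `R`: `|∫ D²π[φu](u,u)| ≤ B · (C/√(-τ)) · F / R`. Near sources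
(`|x - x₀| < 4R`): Hessian–Laplacian identity in `L²` and ONE factor `‖u‖_∞`; far sources: the
source `g = div(φu) = u·∇φ` has `∫ g = 0`, so `|D²π[φu](x)| ≤ c R ‖g‖₁ |x - x₀|⁻⁴` (two-centre
kernel bound), dyadic shells and covering numbers, again ONE factor `‖u‖_∞` (inside `‖g‖₁`). -/
def TestSideFluxBound : Prop :=
  ∃ B : ℝ, 0 ≤ B ∧
    ∀ (C : ℝ) (u : ℝ → ℝ³ → ℝ³), IsTypeIAncientMild C u →
      ∀ R : ℝ, 0 < R → ∀ (x₀ : ℝ³) (φ : ℝ³ → ℝ), ContDiff ℝ ∞ φ →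
        tsupport φ ⊆ closedBall x₀ (2 * R) → (∀ x, ‖gradient φ x‖ ≤ R⁻¹) →
        ∀ τ : ℝ, τ < 0 → ∀ F : ℝ,
          (∀ x' : ℝ³, ∫ x in ball x' R, ‖u τ x‖ ^ 2 ≤ F) →
          |projDefectPairing (fun x => φ x • u τ x) (u τ)| ≤
            B * (C / Real.sqrt (-τ)) * F / R

/-! ## Two elementary facts both cards use (proved) -/

/-- **The entry deposit.** At any time `s < 0` the energy of `u ∈ A_C` in a ball is at most
`C²/(-s)` times its volume (pointwise Type I bound) — with `s = t - R²` this is the Leray rate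
`≤ (4π/3)·C²·R`, the only place the far past is used. -/
theorem entry_deposit {C : ℝ} {u : ℝ → ℝ³ → ℝ³} (hu : IsTypeIAncientMild C u) {s : ℝ} (hs : s < 0)
    (x₀ : ℝ³) (R : ℝ) :
    ∫ x in ball x₀ R, ‖u s x‖ ^ 2 ≤ C ^ 2 / (-s) * volume.real (ball x₀ R) := by
  have hfin : volume (ball x₀ R) < ⊤ := measure_ball_lt_top
  have hpt : ∀ x ∈ ball x₀ R, ‖(‖u s x‖ ^ 2)‖ ≤ C ^ 2 / (-s) := by
    intro x _
    have h1 : ‖u s x‖ ≤ C / Real.sqrt (-s) := hu.norm_le hs x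
    have hC : 0 ≤ C := hu.nonneg
    have hsq : 0 < Real.sqrt (-s) := Real.sqrt_pos.2 (neg_pos.2 hs)
    rw [Real.norm_eq_abs, abs_of_nonneg (by positivity)]
    calc ‖u s x‖ ^ 2 ≤ (C / Real.sqrt (-s)) ^ 2 := by
          exact pow_le_pow_left₀ (norm_nonneg _) h1 2
      _ = C ^ 2 / (-s) := by
          rw [div_pow, Real.sq_sqrt (le_of_lt (neg_pos.2 hs))]
  have h := norm_setIntegral_le_of_norm_le_const hfin hpt
  have hnn : 0 ≤ ∫ x in ball x₀ R, ‖u s x‖ ^ 2 := by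
    exact setIntegral_nonneg measurableSet_ball fun x _ => by positivity
  rw [Real.norm_eq_abs, abs_of_nonneg hnn] at h
  exact h

/-- **The crossing number.** The dimensionless quantity that drives the Gronwall exponent:
`∫_{t-R²}^{t} dτ/√(-τ) = 2(√(R² - t) − √(-t)) ≤ 2R` for every `t < 0`, `R > 0` — the Type I speed
`C/√(-τ)` carries fluid across at most `2C` ball-radii during the last `R²` units of time,
uniformly in `R/√(-t)`. -/
theorem crossing_number_le {t R : ℝ} (ht : t < 0) (hR : 0 < R) :
    ∫ τ in (t - R ^ 2)..t, (Real.sqrt (-τ))⁻¹ ≤ 2 * R := by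
  have hderiv : ∀ τ ∈ Set.uIcc (t - R ^ 2) t,
      HasDerivAt (fun σ => -2 * Real.sqrt (-σ)) ((Real.sqrt (-τ))⁻¹) τ := by
    intro τ hτ
    have hτ0 : τ < 0 := by
      rcases Set.mem_uIcc.1 hτ with h | h
      · exact lt_of_le_of_lt h.2 ht
      · linarith [h.1, sq_nonneg R]
    have hneg : -τ ≠ 0 := by linarith
    have h1 : HasDerivAt (fun σ : ℝ => -σ) (-1) τ := (hasDerivAt_id τ).neg
    have h2 : HasDerivAt (fun σ : ℝ => Real.sqrt (-σ)) (1 / (2 * Real.sqrt (-τ)) * (-1)) τ :=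
      (Real.hasDerivAt_sqrt hneg).comp τ h1
    have h3 := h2.const_mul (-2)
    have hs : Real.sqrt (-τ) ≠ 0 := (Real.sqrt_pos.2 (by linarith)).ne'
    have key : -2 * (1 / (2 * Real.sqrt (-τ)) * -1) = (Real.sqrt (-τ))⁻¹ := by
      calc -2 * (1 / (2 * Real.sqrt (-τ)) * -1) = 2 / (2 * Real.sqrt (-τ)) := by ring
        _ = (Real.sqrt (-τ))⁻¹ := by
          rw [div_mul_eq_div_div, div_self (two_ne_zero : (2 : ℝ) ≠ 0), one_div]
    exact h3.congr_deriv key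
  have hcont : ContinuousOn (fun τ => (Real.sqrt (-τ))⁻¹) (Set.uIcc (t - R ^ 2) t) := by
    refine ContinuousOn.inv₀ ?_ ?_
    · exact (Real.continuous_sqrt.comp continuous_neg).continuousOn
    · intro τ hτ
      have hτ0 : τ < 0 := by
        rcases Set.mem_uIcc.1 hτ with h | h
        · exact lt_of_le_of_lt h.2 ht
        · linarith [h.1, sq_nonneg R]
      exact (Real.sqrt_pos.2 (by linarith)).ne'
  have hint : IntervalIntegrable (fun τ => (Real.sqrt (-τ))⁻¹) volume (t - R ^ 2) t :=
    hcont.intervalIntegrable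
  rw [intervalIntegral.integral_eq_sub_of_hasDerivAt hderiv hint]
  have hR2 : Real.sqrt (-(t - R ^ 2)) ≤ Real.sqrt (-t) + R := by
    have h0 : 0 ≤ Real.sqrt (-t) := Real.sqrt_nonneg _
    rw [Real.sqrt_le_left (by positivity)]
    have hsq : Real.sqrt (-t) ^ 2 = -t := Real.sq_sqrt (le_of_lt (neg_pos.2 ht))
    nlinarith [hsq, h0, hR.le]
  nlinarith [hR2, Real.sqrt_nonneg (-t), Real.sqrt_nonneg (-(t - R ^ 2))]

end Summit.NavierStokesRegularity.NavierStokesRegularity.Cruxes.FarPastLedger.Ideator3
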